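/-
VALUE = THEOREM, NOT summit progress (cell b2b-lgcu-borel, gen 22); crux 14079 untouched.
-/
import Mathlib
import Summits.MatrixMultiplication.MatrixMultiplication.Theorems.SubgroupIdentityDesigns.Negative.SignedCyclicTorus
import Summits.MatrixMultiplication.MatrixMultiplication.Theorems.SubgroupIdentityDesigns.Negative.SummandTransport

/-!
# Placements of the signed cyclic torus `T₁⟨q⟩` (`q = -P`) in a design triple — all excluded

VALUE = THEOREM (every odd `p`, every `m ≥ 3`, every `ε`), NOT summit progress.

From `SignedCyclicTorus.no_design_of_cover` (the split-fixer criterion applied to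
`K = T₁ ⋊ ⟨-P⟩ = T^± ⋊ A₃ ≤ GL₃(𝔽_p)`, order `6(p-1)²`): `T₁ ∪ {q}` inside one member
(`no_design_mem₁/₂/₃`) and the factorisations `T₁ ⊆ H_a`, `q ∈ H_b`, `a ≠ b`
(`no_design_split_ab`) all contradict the level-one identity-design clause of
`SubgroupIdentityDesigns`; and by `SummandTransport.design_comap` the same nine statements hold for
the block-embedded configuration `e · ((T₁ ∪ {q}) ⊕ 1_{m-3}) · e⁻¹ ≤ GL_m(𝔽_p)` for every `m ≥ 3` and
every coordinate embedding `e` (`…_all`).  No TPP, no character budget.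

HONEST SCOPE.  Configuration exclusion; no `(p,m,ε)` cell is emptied.
-/

set_option linter.dupNamespace false

noncomputable section

open scoped BigOperators Classical Matrix

namespace Summit.MatrixMultiplication.MatrixMultiplication.Theorems.SubgroupIdentityDesigns.Negative
namespace SignedCyclicTorus

open Summit.MatrixMultiplication.MatrixMultiplication.Theorems.LieRankDesigns.Negative (GLm Mat)
open SummandTransport (emb design_comap)

variable {p : ℕ} [hp : Fact p.Prime]

/-! ## In `GL₃(𝔽_p)` -/

section GL3

variable {H₁ H₂ H₃ : Subgroup (GLm p 3)}

/-- **`T₁ ∪ {q}` IN `H₁`** ⇒ no level-one identity design (`p` odd, every `ε`, no TPP). -/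
theorem no_design_mem₁ (hp2 : p ≠ 2) (hT : ∀ a b : (ZMod p)ˣ, tor (a, b) ∈ H₁) (hq : q ∈ H₁) :
    ¬ ∃ c : Mat p 3 → ℂ, (∀ M, 1 < M.rank → c M = 0) ∧
      (∑ M, c M * ZMod.stdAddChar (Matrix.trace (M * ((1 : GLm p 3) : Mat p 3)))) = 1 ∧
      ∀ a ∈ H₁, ∀ b ∈ H₂, ∀ g ∈ H₃, a * b * g ≠ 1 →
        (∑ M, c M * ZMod.stdAddChar (Matrix.trace (M * ((a * b * g : GLm p 3) : Mat p 3)))) = 0 :=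
  no_design_of_cover hp2 fun n hn i _ _ => by
    obtain ⟨⟨a, b⟩, rfl⟩ := hn
    exact ⟨_, H₁.mul_mem (hT a b) (H₁.pow_mem hq i), 1, H₂.one_mem, 1, H₃.one_mem,
      by rw [mul_one, mul_one]⟩

/-- **`T₁ ∪ {q}` IN `H₂`.** -/
theorem no_design_mem₂ (hp2 : p ≠ 2) (hT : ∀ a b : (ZMod p)ˣ, tor (a, b) ∈ H₂) (hq : q ∈ H₂) :
    ¬ ∃ c : Mat p 3 → ℂ, (∀ M, 1 < M.rank → c M = 0) ∧
      (∑ M, c M * ZMod.stdAddChar (Matrix.trace (M * ((1 : GLm p 3) : Mat p 3)))) = 1 ∧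
      ∀ a ∈ H₁, ∀ b ∈ H₂, ∀ g ∈ H₃, a * b * g ≠ 1 →
        (∑ M, c M * ZMod.stdAddChar (Matrix.trace (M * ((a * b * g : GLm p 3) : Mat p 3)))) = 0 :=
  no_design_of_cover hp2 fun n hn i _ _ => by
    obtain ⟨⟨a, b⟩, rfl⟩ := hn
    exact ⟨1, H₁.one_mem, _, H₂.mul_mem (hT a b) (H₂.pow_mem hq i), 1, H₃.one_mem,
      by rw [one_mul, mul_one]⟩

/-- **`T₁ ∪ {q}` IN `H₃`.** -/
theorem no_design_mem₃ (hp2 : p ≠ 2) (hT : ∀ a b : (ZMod p)ˣ, tor (a, b) ∈ H₃) (hq : q ∈ H₃) :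
    ¬ ∃ c : Mat p 3 → ℂ, (∀ M, 1 < M.rank → c M = 0) ∧
      (∑ M, c M * ZMod.stdAddChar (Matrix.trace (M * ((1 : GLm p 3) : Mat p 3)))) = 1 ∧
      ∀ a ∈ H₁, ∀ b ∈ H₂, ∀ g ∈ H₃, a * b * g ≠ 1 →
        (∑ M, c M * ZMod.stdAddChar (Matrix.trace (M * ((a * b * g : GLm p 3) : Mat p 3)))) = 0 :=
  no_design_of_cover hp2 fun n hn i _ _ => by
    obtain ⟨⟨a, b⟩, rfl⟩ := hn
    exact ⟨1, H₁.one_mem, 1, H₂.one_mem, _, H₃.mul_mem (hT a b) (H₃.pow_mem hq i),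
      by rw [one_mul, one_mul]⟩

/-- **SPLIT `T₁ ⊆ H₁`, `q ∈ H₂`.** -/
theorem no_design_split₁₂ (hp2 : p ≠ 2) (hT : ∀ a b : (ZMod p)ˣ, tor (a, b) ∈ H₁) (hq : q ∈ H₂) :
    ¬ ∃ c : Mat p 3 → ℂ, (∀ M, 1 < M.rank → c M = 0) ∧
      (∑ M, c M * ZMod.stdAddChar (Matrix.trace (M * ((1 : GLm p 3) : Mat p 3)))) = 1 ∧
      ∀ a ∈ H₁, ∀ b ∈ H₂, ∀ g ∈ H₃, a * b * g ≠ 1 →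
        (∑ M, c M * ZMod.stdAddChar (Matrix.trace (M * ((a * b * g : GLm p 3) : Mat p 3)))) = 0 :=
  SplitFixers.no_design_of_splitFixers₁₂ N q (by norm_num) q_mem_normalizer q_pow_six_mem
    (hone hp2) hfix (N_le_of hT) hq

/-- **SPLIT `T₁ ⊆ H₁`, `q ∈ H₃`.** -/
theorem no_design_split₁₃ (hp2 : p ≠ 2) (hT : ∀ a b : (ZMod p)ˣ, tor (a, b) ∈ H₁) (hq : q ∈ H₃) :
    ¬ ∃ c : Mat p 3 → ℂ, (∀ M, 1 < M.rank → c M = 0) ∧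
      (∑ M, c M * ZMod.stdAddChar (Matrix.trace (M * ((1 : GLm p 3) : Mat p 3)))) = 1 ∧
      ∀ a ∈ H₁, ∀ b ∈ H₂, ∀ g ∈ H₃, a * b * g ≠ 1 →
        (∑ M, c M * ZMod.stdAddChar (Matrix.trace (M * ((a * b * g : GLm p 3) : Mat p 3)))) = 0 :=
  SplitFixers.no_design_of_splitFixers₁₃ N q (by norm_num) q_mem_normalizer q_pow_six_mem
    (hone hp2) hfix (N_le_of hT) hq

/-- **SPLIT `T₁ ⊆ H₂`, `q ∈ H₃`.** -/
theorem no_design_split₂₃ (hp2 : p ≠ 2) (hT : ∀ a b : (ZMod p)ˣ, tor (a, b) ∈ H₂) (hq : q ∈ H₃) :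
    ¬ ∃ c : Mat p 3 → ℂ, (∀ M, 1 < M.rank → c M = 0) ∧
      (∑ M, c M * ZMod.stdAddChar (Matrix.trace (M * ((1 : GLm p 3) : Mat p 3)))) = 1 ∧
      ∀ a ∈ H₁, ∀ b ∈ H₂, ∀ g ∈ H₃, a * b * g ≠ 1 →
        (∑ M, c M * ZMod.stdAddChar (Matrix.trace (M * ((a * b * g : GLm p 3) : Mat p 3)))) = 0 :=
  SplitFixers.no_design_of_splitFixers₂₃ N q (by norm_num) q_mem_normalizer q_pow_six_mem
    (hone hp2) hfix (N_le_of hT) hq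

/-- **SPLIT `q ∈ H₁`, `T₁ ⊆ H₂`.** -/
theorem no_design_split₂₁ (hp2 : p ≠ 2) (hq : q ∈ H₁) (hT : ∀ a b : (ZMod p)ˣ, tor (a, b) ∈ H₂) :
    ¬ ∃ c : Mat p 3 → ℂ, (∀ M, 1 < M.rank → c M = 0) ∧
      (∑ M, c M * ZMod.stdAddChar (Matrix.trace (M * ((1 : GLm p 3) : Mat p 3)))) = 1 ∧
      ∀ a ∈ H₁, ∀ b ∈ H₂, ∀ g ∈ H₃, a * b * g ≠ 1 →
        (∑ M, c M * ZMod.stdAddChar (Matrix.trace (M * ((a * b * g : GLm p 3) : Mat p 3)))) = 0 :=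
  SplitFixers.no_design_of_splitFixers₂₁ N q (by norm_num) q_mem_normalizer q_pow_six_mem
    (hone hp2) hfix hq (N_le_of hT)

/-- **SPLIT `q ∈ H₁`, `T₁ ⊆ H₃`.** -/
theorem no_design_split₃₁ (hp2 : p ≠ 2) (hq : q ∈ H₁) (hT : ∀ a b : (ZMod p)ˣ, tor (a, b) ∈ H₃) :
    ¬ ∃ c : Mat p 3 → ℂ, (∀ M, 1 < M.rank → c M = 0) ∧
      (∑ M, c M * ZMod.stdAddChar (Matrix.trace (M * ((1 : GLm p 3) : Mat p 3)))) = 1 ∧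
      ∀ a ∈ H₁, ∀ b ∈ H₂, ∀ g ∈ H₃, a * b * g ≠ 1 →
        (∑ M, c M * ZMod.stdAddChar (Matrix.trace (M * ((a * b * g : GLm p 3) : Mat p 3)))) = 0 :=
  SplitFixers.no_design_of_splitFixers₃₁ N q (by norm_num) q_mem_normalizer q_pow_six_mem
    (hone hp2) hfix hq (N_le_of hT)

/-- **SPLIT `q ∈ H₂`, `T₁ ⊆ H₃`.** -/
theorem no_design_split₃₂ (hp2 : p ≠ 2) (hq : q ∈ H₂) (hT : ∀ a b : (ZMod p)ˣ, tor (a, b) ∈ H₃) :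
    ¬ ∃ c : Mat p 3 → ℂ, (∀ M, 1 < M.rank → c M = 0) ∧
      (∑ M, c M * ZMod.stdAddChar (Matrix.trace (M * ((1 : GLm p 3) : Mat p 3)))) = 1 ∧
      ∀ a ∈ H₁, ∀ b ∈ H₂, ∀ g ∈ H₃, a * b * g ≠ 1 →
        (∑ M, c M * ZMod.stdAddChar (Matrix.trace (M * ((a * b * g : GLm p 3) : Mat p 3)))) = 0 :=
  SplitFixers.no_design_of_splitFixers₃₂ N q (by norm_num) q_mem_normalizer q_pow_six_mem
    (hone hp2) hfix hq (N_le_of hT)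

end GL3

/-! ## Every dimension `m ≥ 3` (summand transport) -/

section AllDimensions

variable {l m : ℕ} (e : Fin 3 ⊕ Fin l ≃ Fin m) {H₁ H₂ H₃ : Subgroup (GLm p m)}

/-- **`(T₁ ∪ {q}) ⊕ 1` IN `H₁ ≤ GL_m(𝔽_p)`**, every `m ≥ 3`. -/
theorem no_design_mem₁_all (hp2 : p ≠ 2) (hT : ∀ a b : (ZMod p)ˣ, emb e (tor (a, b)) ∈ H₁)
    (hq : emb e q ∈ H₁) :
    ¬ ∃ c : Mat p m → ℂ, (∀ M, 1 < M.rank → c M = 0) ∧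
      (∑ M, c M * ZMod.stdAddChar (Matrix.trace (M * ((1 : GLm p m) : Mat p m)))) = 1 ∧
      ∀ a ∈ H₁, ∀ b ∈ H₂, ∀ g ∈ H₃, a * b * g ≠ 1 →
        (∑ M, c M * ZMod.stdAddChar (Matrix.trace (M * ((a * b * g : GLm p m) : Mat p m)))) = 0 :=
  fun hdes => no_design_mem₁ (H₁ := H₁.comap (emb e)) (H₂ := H₂.comap (emb e))
    (H₃ := H₃.comap (emb e)) hp2 (fun a b => Subgroup.mem_comap.mpr (hT a b))
    (Subgroup.mem_comap.mpr hq) (design_comap e 1 hdes)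

/-- **… IN `H₂`**, every `m ≥ 3`. -/
theorem no_design_mem₂_all (hp2 : p ≠ 2) (hT : ∀ a b : (ZMod p)ˣ, emb e (tor (a, b)) ∈ H₂)
    (hq : emb e q ∈ H₂) :
    ¬ ∃ c : Mat p m → ℂ, (∀ M, 1 < M.rank → c M = 0) ∧
      (∑ M, c M * ZMod.stdAddChar (Matrix.trace (M * ((1 : GLm p m) : Mat p m)))) = 1 ∧
      ∀ a ∈ H₁, ∀ b ∈ H₂, ∀ g ∈ H₃, a * b * g ≠ 1 →
        (∑ M, c M * ZMod.stdAddChar (Matrix.trace (M * ((a * b * g : GLm p m) : Mat p m)))) = 0 :=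
  fun hdes => no_design_mem₂ (H₁ := H₁.comap (emb e)) (H₂ := H₂.comap (emb e))
    (H₃ := H₃.comap (emb e)) hp2 (fun a b => Subgroup.mem_comap.mpr (hT a b))
    (Subgroup.mem_comap.mpr hq) (design_comap e 1 hdes)

/-- **… IN `H₃`**, every `m ≥ 3`. -/
theorem no_design_mem₃_all (hp2 : p ≠ 2) (hT : ∀ a b : (ZMod p)ˣ, emb e (tor (a, b)) ∈ H₃)
    (hq : emb e q ∈ H₃) :
    ¬ ∃ c : Mat p m → ℂ, (∀ M, 1 < M.rank → c M = 0) ∧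
      (∑ M, c M * ZMod.stdAddChar (Matrix.trace (M * ((1 : GLm p m) : Mat p m)))) = 1 ∧
      ∀ a ∈ H₁, ∀ b ∈ H₂, ∀ g ∈ H₃, a * b * g ≠ 1 →
        (∑ M, c M * ZMod.stdAddChar (Matrix.trace (M * ((a * b * g : GLm p m) : Mat p m)))) = 0 :=
  fun hdes => no_design_mem₃ (H₁ := H₁.comap (emb e)) (H₂ := H₂.comap (emb e))
    (H₃ := H₃.comap (emb e)) hp2 (fun a b => Subgroup.mem_comap.mpr (hT a b))
    (Subgroup.mem_comap.mpr hq) (design_comap e 1 hdes)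

/-- **SPLIT `T₁ ⊕ 1 ⊆ H₁`, `q ⊕ 1 ∈ H₂`**, every `m ≥ 3`. -/
theorem no_design_split₁₂_all (hp2 : p ≠ 2) (hT : ∀ a b : (ZMod p)ˣ, emb e (tor (a, b)) ∈ H₁)
    (hq : emb e q ∈ H₂) :
    ¬ ∃ c : Mat p m → ℂ, (∀ M, 1 < M.rank → c M = 0) ∧
      (∑ M, c M * ZMod.stdAddChar (Matrix.trace (M * ((1 : GLm p m) : Mat p m)))) = 1 ∧
      ∀ a ∈ H₁, ∀ b ∈ H₂, ∀ g ∈ H₃, a * b * g ≠ 1 →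
        (∑ M, c M * ZMod.stdAddChar (Matrix.trace (M * ((a * b * g : GLm p m) : Mat p m)))) = 0 :=
  fun hdes => no_design_split₁₂ (H₁ := H₁.comap (emb e)) (H₂ := H₂.comap (emb e))
    (H₃ := H₃.comap (emb e)) hp2 (fun a b => Subgroup.mem_comap.mpr (hT a b))
    (Subgroup.mem_comap.mpr hq) (design_comap e 1 hdes)

/-- **SPLIT `T₁ ⊕ 1 ⊆ H₁`, `q ⊕ 1 ∈ H₃`**, every `m ≥ 3`. -/
theorem no_design_split₁₃_all (hp2 : p ≠ 2) (hT : ∀ a b : (ZMod p)ˣ, emb e (tor (a, b)) ∈ H₁)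
    (hq : emb e q ∈ H₃) :
    ¬ ∃ c : Mat p m → ℂ, (∀ M, 1 < M.rank → c M = 0) ∧
      (∑ M, c M * ZMod.stdAddChar (Matrix.trace (M * ((1 : GLm p m) : Mat p m)))) = 1 ∧
      ∀ a ∈ H₁, ∀ b ∈ H₂, ∀ g ∈ H₃, a * b * g ≠ 1 →
        (∑ M, c M * ZMod.stdAddChar (Matrix.trace (M * ((a * b * g : GLm p m) : Mat p m)))) = 0 :=
  fun hdes => no_design_split₁₃ (H₁ := H₁.comap (emb e)) (H₂ := H₂.comap (emb e))
    (H₃ := H₃.comap (emb e)) hp2 (fun a b => Subgroup.mem_comap.mpr (hT a b))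
    (Subgroup.mem_comap.mpr hq) (design_comap e 1 hdes)

/-- **SPLIT `T₁ ⊕ 1 ⊆ H₂`, `q ⊕ 1 ∈ H₃`**, every `m ≥ 3`. -/
theorem no_design_split₂₃_all (hp2 : p ≠ 2) (hT : ∀ a b : (ZMod p)ˣ, emb e (tor (a, b)) ∈ H₂)
    (hq : emb e q ∈ H₃) :
    ¬ ∃ c : Mat p m → ℂ, (∀ M, 1 < M.rank → c M = 0) ∧
      (∑ M, c M * ZMod.stdAddChar (Matrix.trace (M * ((1 : GLm p m) : Mat p m)))) = 1 ∧
      ∀ a ∈ H₁, ∀ b ∈ H₂, ∀ g ∈ H₃, a * b * g ≠ 1 →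
        (∑ M, c M * ZMod.stdAddChar (Matrix.trace (M * ((a * b * g : GLm p m) : Mat p m)))) = 0 :=
  fun hdes => no_design_split₂₃ (H₁ := H₁.comap (emb e)) (H₂ := H₂.comap (emb e))
    (H₃ := H₃.comap (emb e)) hp2 (fun a b => Subgroup.mem_comap.mpr (hT a b))
    (Subgroup.mem_comap.mpr hq) (design_comap e 1 hdes)

/-- **SPLIT `q ⊕ 1 ∈ H₁`, `T₁ ⊕ 1 ⊆ H₂`**, every `m ≥ 3`. -/
theorem no_design_split₂₁_all (hp2 : p ≠ 2) (hq : emb e q ∈ H₁)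
    (hT : ∀ a b : (ZMod p)ˣ, emb e (tor (a, b)) ∈ H₂) :
    ¬ ∃ c : Mat p m → ℂ, (∀ M, 1 < M.rank → c M = 0) ∧
      (∑ M, c M * ZMod.stdAddChar (Matrix.trace (M * ((1 : GLm p m) : Mat p m)))) = 1 ∧
      ∀ a ∈ H₁, ∀ b ∈ H₂, ∀ g ∈ H₃, a * b * g ≠ 1 →
        (∑ M, c M * ZMod.stdAddChar (Matrix.trace (M * ((a * b * g : GLm p m) : Mat p m)))) = 0 :=
  fun hdes => no_design_split₂₁ (H₁ := H₁.comap (emb e)) (H₂ := H₂.comap (emb e))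
    (H₃ := H₃.comap (emb e)) hp2 (Subgroup.mem_comap.mpr hq)
    (fun a b => Subgroup.mem_comap.mpr (hT a b)) (design_comap e 1 hdes)

/-- **SPLIT `q ⊕ 1 ∈ H₁`, `T₁ ⊕ 1 ⊆ H₃`**, every `m ≥ 3`. -/
theorem no_design_split₃₁_all (hp2 : p ≠ 2) (hq : emb e q ∈ H₁)
    (hT : ∀ a b : (ZMod p)ˣ, emb e (tor (a, b)) ∈ H₃) :
    ¬ ∃ c : Mat p m → ℂ, (∀ M, 1 < M.rank → c M = 0) ∧
      (∑ M, c M * ZMod.stdAddChar (Matrix.trace (M * ((1 : GLm p m) : Mat p m)))) = 1 ∧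
      ∀ a ∈ H₁, ∀ b ∈ H₂, ∀ g ∈ H₃, a * b * g ≠ 1 →
        (∑ M, c M * ZMod.stdAddChar (Matrix.trace (M * ((a * b * g : GLm p m) : Mat p m)))) = 0 :=
  fun hdes => no_design_split₃₁ (H₁ := H₁.comap (emb e)) (H₂ := H₂.comap (emb e))
    (H₃ := H₃.comap (emb e)) hp2 (Subgroup.mem_comap.mpr hq)
    (fun a b => Subgroup.mem_comap.mpr (hT a b)) (design_comap e 1 hdes)

/-- **SPLIT `q ⊕ 1 ∈ H₂`, `T₁ ⊕ 1 ⊆ H₃`**, every `m ≥ 3`. -/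
theorem no_design_split₃₂_all (hp2 : p ≠ 2) (hq : emb e q ∈ H₂)
    (hT : ∀ a b : (ZMod p)ˣ, emb e (tor (a, b)) ∈ H₃) :
    ¬ ∃ c : Mat p m → ℂ, (∀ M, 1 < M.rank → c M = 0) ∧
      (∑ M, c M * ZMod.stdAddChar (Matrix.trace (M * ((1 : GLm p m) : Mat p m)))) = 1 ∧
      ∀ a ∈ H₁, ∀ b ∈ H₂, ∀ g ∈ H₃, a * b * g ≠ 1 →
        (∑ M, c M * ZMod.stdAddChar (Matrix.trace (M * ((a * b * g : GLm p m) : Mat p m)))) = 0 :=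
  fun hdes => no_design_split₃₂ (H₁ := H₁.comap (emb e)) (H₂ := H₂.comap (emb e))
    (H₃ := H₃.comap (emb e)) hp2 (Subgroup.mem_comap.mpr hq)
    (fun a b => Subgroup.mem_comap.mpr (hT a b)) (design_comap e 1 hdes)

end AllDimensions

end SignedCyclicTorus
end Summit.MatrixMultiplication.MatrixMultiplication.Theorems.SubgroupIdentityDesigns.Negative
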